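import Literature.Geometry.Kaehler.MilnorSymbolDlogDescent
import Literature.Geometry.Kaehler.CechDeRhamTransgressionExists
import Literature.Geometry.Kaehler.MatrixFormLocalCalculus
import Literature.Geometry.Kaehler.HolomorphicFunctionsDolbeault
import Literature.NumberTheory.Transcendental.ComplexFormsProofs
import Mathlib.Analysis.SpecialFunctions.Complex.LogDeriv
import HarnessLib

/-!
# Every Milnor symbol cocycle transgresses: the symbol forms are smooth, closed and `δ`-closed

`HodgeModel.HasSymbolCocycle q c` asks for (i) a Čech `(q+1)`-cocycle `σ` of Milnor symbols
modulo the naive relations on a finite open cover, (ii) a closed `(2q+2)`-form `θ` reached from the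
symbol forms `w_J = ∧^{q+1} dlog (σ_J)` by the Čech–de Rham zig-zag, and (iii) the identity
`A.deRham [θ] = m • A^* c`. This file shows that (ii) is AUTOMATIC: on a complex manifold with a
smooth partition of unity subordinate to the cover, every Milnor symbol cocycle `σ` has a
transgression `θ`, and every such `θ` is smooth and closed. So a constructive proof of the kernel
has to produce the cocycle (i) and to compute one de Rham class (iii) — nothing else.

* `smoothAt_dlog`, `mextDeriv_dlog_apply_eq_zero` — for a holomorphic unit `f` on an open `W`,
  `dlog f = f⁻¹ df` is smooth and CLOSED at the points of `W` (locally `dlog f = d log (f/f(x))`,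
  chain rule through `Complex.log` on the slit plane, and `d ∘ d = 0`);
* `smoothAt_dlogWedge`, `mextDeriv_dlogWedge_apply_eq_zero`, `smoothAt_symbolForm`,
  `mextDeriv_symbolForm_apply_eq_zero` — hence the symbol form of a chain of good tuples on `W` is
  smooth and closed at the points of `W` (Leibniz rule for `∧`);
* `IsMilnorSymbolCocycle.exists_isTransgression` — **every Milnor symbol `(q+1)`-cocycle of
  weight `q + 1` on a finite open cover with a subordinate smooth partition of unity transgresses**:
  `∃ θ, IsTransgression hU q (fun J ↦ symbolForm E (q+1) (σ J)) θ` (the `δw = 0` input is the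
  general-weight descent `sum_symbolForm_face_apply_eq_zero` of `MilnorSymbolDlogDescent`, the zig-zag
  is `exists_isTransgression` of `CechDeRhamTransgressionExists`), and `θ` may be taken in
  `cclosedSmoothForms` (`exists_isTransgression_cclosed`); on a compact (σ-compact, Hausdorff)
  complex manifold the partition of unity exists for every finite open cover
  (`exists_isTransgression_of_cover`).

References: R. Bott, L. W. Tu, *Differential Forms in Algebraic Topology* (1982), Prop. 8.5, 8.8;
H. Esnault, E. Viehweg, *Deligne–Beilinson cohomology* (1988), §7; C. Voisin, *Hodge Theory and
Complex Algebraic Geometry I* (2002), §3.3.1 and proof of Thm. 7.10 (`dlog g_{ij}` and its zig-zag).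

Provenance: Literature home (namespace `Literature.Geometry.Kaehler.MilnorSymbolNaive`) of the Summits-side `Theorems/MilnorKExponentialSymbolLiftRMilnorTransgression` (route `MilnorKExponential` of the Hodge summit, crux `SymbolLiftR`; all its imports are `Literature/`, Mathlib and the already re-homed `MilnorSymbolDlogDescent` ∕ `CechDeRhamTransgressionExists`); theorems only, no named fact, no definition; the dot-notation lemma is declared as `IsMilnorSymbolCocycle.exists_isTransgression'` (the unprimed FQN belongs to the Summits file). Lane `lit-hodgefound` (Layer A1: Čech–de Rham calculus, Milnor symbols and symbol classes), seat p20.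
-/

noncomputable section

-- `TangentSpace 𝓘(ℝ, E) x = E` is an abuse of definitional equality; let `isDefEq` unfold it.
set_option backward.isDefEq.respectTransparency false

open scoped Manifold _root_.Topology ContDiff
open Set Function Filter Complex

namespace Literature.Geometry.Kaehler.MilnorSymbolNaive

open Literature.Geometry.Kaehler.CechDeRham

open Literature.Geometry.Kaehler Literature.NumberTheory.Transcendental

variable {E : Type*} [NormedAddCommGroup E] [NormedSpace ℂ E]
  {M : Type*} [TopologicalSpace M] [ChartedSpace E M]

/-! ### `dlog` of a holomorphic unit is smooth and closed -/

section Dlog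

variable [IsManifold 𝓘(ℂ, E) ω M] [IsManifold 𝓘(ℝ, E) ∞ M]

/-- A holomorphic function on an open `W` defines a `0`-form smooth at the points of `W`.
 [cite: BottTu1982Forms, §8 Prop. 8.8] -/
theorem smoothAt_ofFun_of_mdifferentiableOn [FiniteDimensional ℂ E] {W : Set M} (hW : IsOpen W)
    {f : M → ℂ} (hf : MDifferentiableOn 𝓘(ℂ, E) 𝓘(ℂ, ℂ) f W) {x : M} (hx : x ∈ W) :
    (MForm.ofFun 𝓘(ℝ, E) f).SmoothAt x :=
  MForm.smoothAt_ofFun_of_contMDiffAt (contMDiffAt_real_of_mdifferentiableOn_complex hf hW hx)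

omit [IsManifold 𝓘(ℂ, E) ω M] in
/-- **Chain rule for the local logarithm**: if `f` is holomorphic near `y` (on the open `W ∋ y`)
and `c · f y` lies in the slit plane, then `d (log (c f)) = f⁻¹ df` at `y` (`c ≠ 0`).
[cite: VoisinHodgeI2002, §3.3.1] -/
theorem mextDeriv_ofFun_log_const_mul_apply {W : Set M} (hW : IsOpen W) {f : M → ℂ}
    (hf : MDifferentiableOn 𝓘(ℂ, E) 𝓘(ℂ, ℂ) f W) {y : M} (hy : y ∈ W) {c : ℂ} (hc : c ≠ 0)
    (hslit : c * f y ∈ slitPlane) (v : Fin 1 → TangentSpace 𝓘(ℝ, E) y) :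
    mextDeriv (MForm.ofFun 𝓘(ℝ, E) fun z ↦ log (c * f z)) y v = (f y)⁻¹ • mextDeriv (MForm.ofFun 𝓘(ℝ, E) f) y v := by
  -- real differentiability of the chart reading of the holomorphic `f` at `y`
  have hg := ((differentiableAt_comp_extChartAt_symm_of_mdifferentiableAt
    ((hf y hy).mdifferentiableAt (hW.mem_nhds hy))).restrictScalars ℝ).hasFDerivAt
  have hy0 : (f ∘ (extChartAt 𝓘(ℝ, E) y).symm) (extChartAt 𝓘(ℝ, E) y y) = f y := by simp
  have hslit' : c * (f ∘ (extChartAt 𝓘(ℝ, E) y).symm) (extChartAt 𝓘(ℝ, E) y y) ∈ slitPlane := by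
    rwa [hy0]
  have hcomp : HasFDerivAt ((fun z ↦ log (c * f z)) ∘ (extChartAt 𝓘(ℝ, E) y).symm)
      (((c * f y)⁻¹ • (1 : ℂ →L[ℝ] ℂ)).comp
        (c • fderiv ℝ (f ∘ (extChartAt 𝓘(ℝ, E) y).symm) (extChartAt 𝓘(ℝ, E) y y)))
      (extChartAt 𝓘(ℝ, E) y y) := by
    have h := (hasStrictFDerivAt_log_real hslit').hasFDerivAt.comp (extChartAt 𝓘(ℝ, E) y y)
      (hg.const_mul c)
    rw [hy0] at h
    exact h
  rw [mextDeriv_ofFun_apply', mextDeriv_ofFun_apply', hcomp.fderiv]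
  change (c * f y)⁻¹ • (c • fderiv ℝ (f ∘ (extChartAt 𝓘(ℝ, E) y).symm) (extChartAt 𝓘(ℝ, E) y y) (v 0)) =
    (f y)⁻¹ • fderiv ℝ (f ∘ (extChartAt 𝓘(ℝ, E) y).symm) (extChartAt 𝓘(ℝ, E) y y) (v 0)
  have hfy : f y ≠ 0 := fun h ↦ slitPlane_ne_zero hslit (by rw [h, mul_zero])
  have key : ∀ D : ℂ, (c * f y)⁻¹ • (c • D) = (f y)⁻¹ • D := fun D ↦ by
    simp only [smul_eq_mul]
    field_simp
  exact key _

/-- **`dlog` of a holomorphic unit is smooth and closed.** For `f` holomorphic and non-vanishing on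
an open `W` and `x ∈ W`: the logarithmic differential `dlog f = f⁻¹ df` is smooth at `x` and
`d (dlog f) = 0` at `x` — near `x`, `dlog f = d log (f / f(x))` for the local logarithm through the
slit plane, and `d ∘ d = 0` (Voisin (2002), §3.3.1: `dlog g_{ij}` is a closed holomorphic form).
[cite: VoisinHodgeI2002, §3.3.1] -/
theorem smoothAt_dlog_and_mextDeriv_dlog [FiniteDimensional ℂ E] {W : Set M} (hW : IsOpen W)
    {f : M → ℂ} (hf : IsHolUnitOn E W f) {x : M} (hx : x ∈ W) :
    (dlog E f).SmoothAt x ∧ mextDeriv (dlog E f) x = 0 := by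
  set c : ℂ := (f x)⁻¹ with hc
  have hc0 : c ≠ 0 := inv_ne_zero (hf.2 x hx)
  -- the open neighbourhood `O = W ∩ {c f ∈ slitPlane}` of `x`
  set O : Set M := W ∩ (fun z ↦ c * f z) ⁻¹' slitPlane with hO
  have hcont : ContinuousOn (fun z ↦ c * f z) W := continuousOn_const.mul hf.1.continuousOn
  have hOo : IsOpen O := hcont.isOpen_inter_preimage hW isOpen_slitPlane
  have hxO : x ∈ O := ⟨hx, by
    change (f x)⁻¹ * f x ∈ slitPlane
    rw [inv_mul_cancel₀ (hf.2 x hx)]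
    exact one_mem_slitPlane⟩
  -- the local logarithm `ℓ = log (c f)`, holomorphic on `O`
  set ℓ : M → ℂ := fun z ↦ log (c * f z) with hℓ
  have hℓhol : MDifferentiableOn 𝓘(ℂ, E) 𝓘(ℂ, ℂ) ℓ O := by
    intro y hy
    have h1 : MDifferentiableWithinAt 𝓘(ℂ, E) 𝓘(ℂ, ℂ) (fun z ↦ c * f z) O y :=
      ((mdifferentiableOn_const.mul hf.1) y hy.1).mono inter_subset_left
    exact DifferentiableAt.comp_mdifferentiableWithinAt (g := log) (f := fun z ↦ c * f z) (s := O)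
      (x := y) (Complex.differentiableAt_log hy.2) h1
  have hℓs : ∀ᶠ y in 𝓝 x, (MForm.ofFun 𝓘(ℝ, E) ℓ).SmoothAt y := by
    filter_upwards [hOo.mem_nhds hxO] with y hy using smoothAt_ofFun_of_mdifferentiableOn hOo hℓhol hy
  -- `dℓ = dlog f` near `x`
  have hev : ∀ᶠ y in 𝓝 x, mextDeriv (MForm.ofFun 𝓘(ℝ, E) ℓ) y = dlog E f y := by
    filter_upwards [hOo.mem_nhds hxO] with y hy
    ext v
    rw [dlog_apply, ContinuousAlternatingMap.smul_apply,
      mextDeriv_ofFun_log_const_mul_apply hW hf.1 hy.1 hc0 hy.2 v]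
  refine ⟨(MForm.SmoothAt.mextDeriv hℓs).congr_of_eventuallyEq hev, ?_⟩
  rw [← mextDeriv_congr_of_eventuallyEq hev]
  exact mextDeriv_mextDeriv_of_smoothAt hℓs

/-- `dlog` of a holomorphic unit on an open `W` is smooth at the points of `W`.
[cite: VoisinHodgeI2002, §3.3.1] -/
theorem smoothAt_dlog [FiniteDimensional ℂ E] {W : Set M} (hW : IsOpen W) {f : M → ℂ}
    (hf : IsHolUnitOn E W f) {x : M} (hx : x ∈ W) : (dlog E f).SmoothAt x :=
  (smoothAt_dlog_and_mextDeriv_dlog hW hf hx).1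

/-- `dlog` of a holomorphic unit on an open `W` is closed at the points of `W`.
[cite: VoisinHodgeI2002, §3.3.1] -/
theorem mextDeriv_dlog_apply_eq_zero [FiniteDimensional ℂ E] {W : Set M} (hW : IsOpen W)
    {f : M → ℂ} (hf : IsHolUnitOn E W f) {x : M} (hx : x ∈ W) : mextDeriv (dlog E f) x = 0 :=
  (smoothAt_dlog_and_mextDeriv_dlog hW hf hx).2

end Dlog

/-! ### Symbol forms of good chains are smooth and closed -/

section SymbolForms

variable [IsManifold 𝓘(ℂ, E) ω M] [IsManifold 𝓘(ℝ, E) ∞ M] [FiniteDimensional ℂ E] {p : ℕ}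

omit [IsManifold 𝓘(ℂ, E) ω M] [IsManifold 𝓘(ℝ, E) ∞ M] [FiniteDimensional ℂ E] in
/-- The empty iterated wedge, the `0`-form `1`, is smooth. [cite: BottTu1982Forms, §8 Prop. 8.8] -/
theorem smoothAt_dlogWedge_zero (t : Fin 0 → M → ℂ) (x : M) : (dlogWedge E 0 t).SmoothAt x := by
  rw [dlogWedge_zero]
  exact MForm.smoothAt_ofFun_of_contMDiffAt contMDiffAt_const

/-- **The symbol form `dlog f₁ ∧ ⋯ ∧ dlog f_p` of a good tuple on an open `W` is smooth at the
points of `W`** (each factor is, and `∧` preserves smoothness at a point). [cite: Warner1983, 2.17] -/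
theorem smoothAt_dlogWedge {W : Set M} (hW : IsOpen W) {t : Fin p → M → ℂ} (ht : IsGoodTuple E W t)
    {x : M} (hx : x ∈ W) : (dlogWedge E p t).SmoothAt x := by
  induction p with
  | zero => exact smoothAt_dlogWedge_zero t x
  | succ p ih =>
    rw [dlogWedge_succ]
    exact (ih (fun i ↦ ht (Fin.castSucc i))).wedge (smoothAt_dlog hW (ht (Fin.last p)) hx)

omit [IsManifold 𝓘(ℂ, E) ω M] [IsManifold 𝓘(ℝ, E) ∞ M] [FiniteDimensional ℂ E] in
/-- A degree-cast form vanishes at a point where the form does. [cite: BottTu1982Forms, §8 Prop. 8.8] -/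
theorem castDeg_apply_eq_zero' {k k' : ℕ} (e : k = k') {α : MForm 𝓘(ℝ, E) M ℂ k} {x : M}
    (h : α x = 0) : α.castDeg e x = 0 := by
  subst e
  exact h

/-- **The symbol form of a good tuple is closed at the points of `W`**: `d (dlog f₁ ∧ ⋯ ∧ dlog f_p) = 0`
(Leibniz rule at a point, each `dlog fᵢ` being closed there). [cite: Warner1983, Thm. 2.20] -/
theorem mextDeriv_dlogWedge_apply_eq_zero {W : Set M} (hW : IsOpen W) {t : Fin p → M → ℂ}
    (ht : IsGoodTuple E W t) {x : M} (hx : x ∈ W) : mextDeriv (dlogWedge E p t) x = 0 := by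
  induction p with
  | zero =>
    rw [dlogWedge_zero, mextDeriv_ofFun_const]
    rfl
  | succ p ih =>
    rw [dlogWedge_succ,
      mextDeriv_wedge_apply_of_smoothAt (smoothAt_dlogWedge hW (fun i ↦ ht (Fin.castSucc i)) hx)
        (smoothAt_dlog hW (ht (Fin.last p)) hx)]
    have h1 : ((mextDeriv (dlogWedge E p fun i ↦ t (Fin.castSucc i))).wedge
        (dlog E (t (Fin.last p)))) x = 0 := by
      rw [MForm.wedge_apply, ih (fun i ↦ ht (Fin.castSucc i))]
      exact ContinuousAlternatingMap.zero_wedge (V := E) _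
    have h2 : ((dlogWedge E p fun i ↦ t (Fin.castSucc i)).wedge
        (mextDeriv (dlog E (t (Fin.last p))))) x = 0 := by
      rw [MForm.wedge_apply, mextDeriv_dlog_apply_eq_zero hW (ht (Fin.last p)) hx]
      exact ContinuousAlternatingMap.wedge_zero (V := E) _
    rw [castDeg_apply_eq_zero' _ h1, Pi.smul_apply, h2, smul_zero, add_zero]

omit [IsManifold 𝓘(ℂ, E) ω M] [IsManifold 𝓘(ℝ, E) ∞ M] [FiniteDimensional ℂ E] in
/-- The symbol form of a chain as a finite sum of real multiples of iterated wedges. [cite: BottTu1982Forms, §8 Prop. 8.8] -/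
theorem symbolForm_eq_sum (σ : (Fin p → M → ℂ) →₀ ℤ) :
    symbolForm E p σ = ∑ t ∈ σ.support, ((σ t : ℤ) : ℝ) • dlogWedge E p t := by
  rw [symbolForm, Finsupp.sum]
  exact Finset.sum_congr rfl fun t _ ↦ (Int.cast_smul_eq_zsmul ℝ (σ t) _).symm

/-- **The symbol form of a chain of good tuples on an open `W` is smooth at the points of `W`.**
[cite: Warner1983, 2.17] -/
theorem smoothAt_symbolForm {W : Set M} (hW : IsOpen W) {σ : (Fin p → M → ℂ) →₀ ℤ}
    (hσ : ∀ t ∈ σ.support, IsGoodTuple E W t) {x : M} (hx : x ∈ W) : (symbolForm E p σ).SmoothAt x := by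
  rw [symbolForm_eq_sum]
  exact MForm.smoothAt_sum _ fun t ht ↦ (smoothAt_dlogWedge hW (hσ t ht) hx).smul _

/-- **The symbol form of a chain of good tuples on an open `W` is closed at the points of `W`.**
[cite: Warner1983, Thm. 2.20] -/
theorem mextDeriv_symbolForm_apply_eq_zero {W : Set M} (hW : IsOpen W) {σ : (Fin p → M → ℂ) →₀ ℤ}
    (hσ : ∀ t ∈ σ.support, IsGoodTuple E W t) {x : M} (hx : x ∈ W) :
    mextDeriv (symbolForm E p σ) x = 0 := by
  rw [symbolForm_eq_sum,
    mextDeriv_sum_apply_of_smoothAt _ fun t ht ↦ (smoothAt_dlogWedge hW (hσ t ht) hx).smul _]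
  refine Finset.sum_eq_zero fun t ht ↦ ?_
  rw [mextDeriv_smul, Pi.smul_apply, mextDeriv_dlogWedge_apply_eq_zero hW (hσ t ht) hx, smul_zero]

end SymbolForms

/-! ### Every Milnor symbol cocycle transgresses -/

section Cocycles

variable [IsManifold 𝓘(ℂ, E) ω M] [IsManifold 𝓘(ℝ, E) ∞ M] [FiniteDimensional ℂ E]
  {ι : Type*} {U : ι → Set M}

/-- **Every Milnor symbol cocycle transgresses.** On a complex manifold, let `𝔘 = (U_i)` be a
finite open cover with a subordinate smooth partition of unity and `σ` a Čech `(q+1)`-cochain of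
chains of good tuples of weight `q + 1` whose differential lies in the naive Milnor relations
(`IsMilnorSymbolCocycle E U σ`). Then the symbol forms `w_J = ∧^{q+1} dlog (σ_J)` — smooth and
closed on `U_J` (`smoothAt_symbolForm`, `mextDeriv_symbolForm_apply_eq_zero`) and `δ`-closed on
the nose on `U_{J'}` (`sum_symbolForm_face_apply_eq_zero`: the symbol form kills the naive
relations in every weight) — are reached by a Čech–de Rham zig-zag from some global
`(2q+2)`-form `θ`: `IsTransgression hU q w θ` (`exists_isTransgression`). [cite: BottTu1982Forms, §8 Prop. 8.8] -/
theorem _root_.Literature.Geometry.Kaehler.IsMilnorSymbolCocycle.exists_isTransgression' [Fintype ι]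
    (hU : ∀ i, IsOpen (U i)) (ρ : SmoothPartitionOfUnity ι 𝓘(ℝ, E) M univ) (hρ : ρ.IsSubordinate U)
    (hcov : ∀ y : M, ∃ i, y ∈ U i) {q : ℕ}
    {σ : (Fin (q + 2) → ι) → ((Fin (q + 1) → M → ℂ) →₀ ℤ)} (hσ : IsMilnorSymbolCocycle E U σ) :
    ∃ θ : MForm 𝓘(ℝ, E) M ℂ (2 * q + 1 + 1),
      IsTransgression hU q (fun J ↦ symbolForm E (q + 1) (σ J)) θ := by
  refine Literature.Geometry.Kaehler.CechDeRham.exists_isTransgression hU ρ hρ hcov q _ (fun J x hx ↦ ?_) (fun J x hx ↦ ?_)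
    (fun J' x hx ↦ ?_)
  · exact smoothAt_symbolForm (isOpen_cechSet hU J) (fun t ht ↦ hσ.good J ht) hx
  · exact mextDeriv_symbolForm_apply_eq_zero (isOpen_cechSet hU J) (fun t ht ↦ hσ.good J ht) hx
  · have h := sum_symbolForm_face_apply_eq_zero hU hσ J' hx
    rw [← h, Finset.sum_apply, Finset.sum_apply]
    refine Finset.sum_congr rfl fun j _ ↦ ?_
    rw [Pi.smul_apply, Pi.smul_apply, ← Int.cast_smul_eq_zsmul ℝ, Int.cast_pow, Int.cast_neg,
      Int.cast_one]

/-- The same, with the bottom form packaged as a closed smooth complex form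
(`cclosedSmoothForms`, the type in which `HodgeModel.HasSymbolCocycle` asks for it).
[cite: BottTu1982Forms, §8 Prop. 8.8] -/
theorem exists_isTransgression_cclosed [Fintype ι]
    (hU : ∀ i, IsOpen (U i)) (ρ : SmoothPartitionOfUnity ι 𝓘(ℝ, E) M univ) (hρ : ρ.IsSubordinate U)
    (hcov : ∀ y : M, ∃ i, y ∈ U i) {q : ℕ}
    {σ : (Fin (q + 2) → ι) → ((Fin (q + 1) → M → ℂ) →₀ ℤ)} (hσ : IsMilnorSymbolCocycle E U σ) :
    ∃ θ : cclosedSmoothForms E M (2 * q + 1 + 1),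
      IsTransgression hU q (fun J ↦ symbolForm E (q + 1) (σ J)) (θ : MForm 𝓘(ℝ, E) M ℂ _) := by
  obtain ⟨θ, hθ⟩ := hσ.exists_isTransgression' hU ρ hρ hcov
  exact ⟨⟨θ, Submodule.subset_span (hθ.mem_closedSmoothForms hcov)⟩, hθ⟩

/-- **On a σ-compact Hausdorff complex manifold every Milnor symbol cocycle on a finite open cover
transgresses to a closed smooth form** (the partition of unity exists by Mathlib's
`SmoothPartitionOfUnity.exists_isSubordinate`). In particular on the carrier of a Hodge model of a
smooth projective variety (compact, Hausdorff) the zig-zag clause of `HodgeModel.HasSymbolCocycle`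
is free: only the cocycle and one de Rham class remain to be produced. [cite: BottTu1982Forms, §8 Prop. 8.8] -/
theorem exists_isTransgression_of_cover [T2Space M] [SigmaCompactSpace M] [Fintype ι]
    (hU : ∀ i, IsOpen (U i)) (hcov : ∀ y : M, ∃ i, y ∈ U i) {q : ℕ}
    {σ : (Fin (q + 2) → ι) → ((Fin (q + 1) → M → ℂ) →₀ ℤ)} (hσ : IsMilnorSymbolCocycle E U σ) :
    ∃ θ : cclosedSmoothForms E M (2 * q + 1 + 1),
      IsTransgression hU q (fun J ↦ symbolForm E (q + 1) (σ J)) (θ : MForm 𝓘(ℝ, E) M ℂ _) := by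
  have hsub : (univ : Set M) ⊆ ⋃ i, U i := fun y _ ↦ mem_iUnion.2 (hcov y)
  obtain ⟨ρ, hρ⟩ := SmoothPartitionOfUnity.exists_isSubordinate 𝓘(ℝ, E) isClosed_univ U hU hsub
  exact exists_isTransgression_cclosed hU ρ hρ hcov hσ

end Cocycles

/-- Packaged (closed) form `isMilnorSymbolCocycle_exists_isTransgression_closed`: `exists_isTransgression_of_cover`, stated closed. [cite: BottTu1982Forms, §8 Prop. 8.8] -/
theorem isMilnorSymbolCocycle_exists_isTransgression_closed : ∀ {E : Type*} [NormedAddCommGroup E] [NormedSpace ℂ E] {M : Type*} [TopologicalSpace M] [ChartedSpace E M] [IsManifold 𝓘(ℂ, E) ω M] [IsManifold 𝓘(ℝ, E) ∞ M] [FiniteDimensional ℂ E] {ι : Type*} {U : ι → Set M} [T2Space M] [SigmaCompactSpace M] [Fintype ι] (hU : ∀ i, IsOpen (U i)), (∀ y : M, ∃ i, y ∈ U i) → ∀ {q : ℕ} {σ : (Fin (q + 2) → ι) → ((Fin (q + 1) → M → ℂ) →₀ ℤ)}, IsMilnorSymbolCocycle E U σ → ∃ θ : cclosedSmoothForms E M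 (2 * q + 1 + 1), IsTransgression hU q (fun J ↦ symbolForm E (q + 1) (σ J)) (θ : MForm 𝓘(ℝ, E) M ℂ _) :=
  fun hU hcov _ _ hσ ↦ exists_isTransgression_of_cover hU hcov hσ

end Literature.Geometry.Kaehler.MilnorSymbolNaive

end
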